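import Mathlib
import HarnessLib
import Summits.SmoothPoincare4.SmoothPoincare4.Theses.SpectralDevelopingMap

/-!
# Line `birth` — BC3 skeleton for the crux `EveryMetricHearsSphere` (stmt-SmoothPoincare4-7413)

Route `SpectralDevelopingMap` (route-SmoothPoincare4-SpectralDevelopingMap), crux H (rank 3):
for every closed smooth 4-manifold `M ≃ₕ S⁴` and EVERY Riemannian metric `g` on `M` there is a smooth
`Φ : M → S⁴ ⊂ ℝ⁵`, equal to a homotopy equivalence, which is a GROUND-STATE MAP for `g`:
`Δ_g Φᵢ = −E Φᵢ` with `E = |dΦ|²_g` (harmonic-map equation into the round sphere) and `λ₁(g, E) ≥ 1`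
(Rayleigh form: `∫ E u = 0 ⇒ ∫ E u² ≤ ∫ |du|²_g`), i.e. Karpukhin–Stern SPECTRAL INDEX `ind_S(Φ) = 1`
(arXiv:2207.13635 Def. 4.8: the number of negative eigenvalues of `L_Φ = Δ_g − |dΦ|²_g`).

## The line = the route's own two-layer plan for H (route header, TWO-LAYER PLAN:
`EveryMetricHearsSphere ⇐ KSWidthMapDegreeOne → KSWidthMapGroundState → H`), typed

Karpukhin–Stern 2024 (Invent. Math.; arXiv:2207.13635), Cor. 1.3 (p. 4): for every closed `(Mⁿ, g)`,
`n ≥ 3`, and every `k ≥ 3` there is a nonconstant stationary harmonic "width map" `u_k : M → Sᵏ` of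
MORSE INDEX `ind_E(u_k) ≤ k + 1`, smooth when `3 ≤ n ≤ 5 ≤ …`, in particular smooth for `n = k = 4`.
What KS do NOT give at `k = 4`: the homotopy class of `u₄` (the min-max sweep-outs are constant maps on
`∂B⁵`, the Ginzburg–Landau relaxation is `ℝ⁵`-valued, so the degree is not tracked) and the spectral
index (`ind_S = 1` is obtained in Thm. 1.5 only for `k ≥ k(M,g)` LARGE, through the stabilisation
Prop. 1.4/3.8 and the index identity (4.8) `ind_E(i_{k,k'} ∘ u) = ind_E(u) + (k' − k)·ind_S(u)`).
The crux H is cut along exactly that seam, with the Morse index made a first-class typed clause: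

* `EnergyIndexAtMost g Φ E m` — the Morse index of `Φ` as a critical point of the Dirichlet energy is
  `≤ m` ON SMOOTH TANGENTIAL VARIATIONS: among any `m + 1` smooth fields `v_a : M → ℝ⁵` with
  `v_a(x) ⊥ Φ(x)` some non-trivial combination `w = Σ c_a v_a` has second variation
  `Q_Φ(w) = ∫ (|dw|²_g − E |w|²) dv_g ≥ 0` (KS p. 12: `ind_E(u)` = index of `E''(u)` on tangential
  `W^{1,2} ∩ L^∞` fields, for sphere targets `E''(u)(w,w) = ∫ |dw|² − |du|²|w|²`; smooth fields are
  dense, so this is the same number).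
* `stub_widthMapHomotopyEquiv` (= KSWidthMapDegreeOne; open, size XL, the residue of H's topological
  half): for every metric on a homotopy 4-sphere there is a smooth harmonic map `Φ : (M,g) → S⁴`
  (`E = |dΦ|²`, `Δ_g Φᵢ = −E Φᵢ`) which IS a homotopy equivalence and has `ind_E(Φ) ≤ 5`.
  Known part: KS Cor. 1.3 gives everything except "homotopy equivalence" (smoothness included, `n = k = 4`).
  Why it might fail: the KS width map may have degree `0` for some metrics and no other index-`≤ 5`
  harmonic map need be a homotopy equivalence (inf of energy is `0` in every homotopy class, White 1986,
  so no minimisers). NOT the crux reworded: it trades H's analytic clause (`ind_S = 1`, a statement about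
  the bottom of the spectrum of `L_Φ`) for a Morse-index bound on the map, which KS's min-max delivers
  by construction; neither implies the other cheaply (Prop. 4.9 `ind_S ≥ ind_E/(k+1)` goes one way only).
* `stub_lowIndexGroundState` (= KSWidthMapGroundState; open, size L–XL, the residue of H's analytic
  half): on a homotopy 4-sphere, a smooth harmonic homotopy equivalence `Φ : (M,g) → S⁴` with
  `ind_E(Φ) ≤ 5` has `ind_S(Φ) = 1`, i.e. satisfies H's Rayleigh clause. Evidence: `id : S⁴ → S⁴` round
  (`ind_E = 5`, `ind_S = 1`, `λ₁(g, 4) = 1`); KS (4.8)/Prop. 4.9; the trace of `Q_Φ` over the `5`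
  fields `(φ a)ᵀ`, `a ∈` orthonormal basis, is `∫ 4|dφ|² − 2Eφ²`, so a weighted eigenvalue `< 1/2`
  below `1` already forces `ind_E ≥ 6` — the stub is the gap `[1/2, 1)`. Why it might fail: a degree-one
  harmonic self-map of some `(S⁴, g)` with `ind_E ≤ 5` and a weighted eigenvalue in `[1/2, 1)`; KS need
  `k` large precisely here. NOT the crux reworded: it is a universally quantified regularity-type
  implication (no existence), strictly weaker than "every harmonic homotopy equivalence is a ground state".
* `EveryMetricHearsSphere_of : Sig.stub_widthMapHomotopyEquiv → Sig.stub_lowIndexGroundState →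
  EveryMetricHearsSphere` — the composition, sorry-free, concluding the route decl BY NAME; and
  `EveryMetricHearsSphere_proof : EveryMetricHearsSphere` — the skeleton in its final shape (depends on
  `sorryAx` only through the two `stub_*`).

Vocabulary is the route file's (no new notions): `Δ_g = (ofRiemannian g).dalembertian = tr_g Hess`,
`|df|²_g = (ofRiemannian g).innerDual (df, df)` with `df = mvfderiv (𝓡 4) f x`, `dv_g =
riemannianMeasure g`; the standing binder `(ofRiemannian g).HasLeviCivita` is a theorem
(`PseudoRiemannianMetric.hasLeviCivita`) kept as a hypothesis exactly as in the crux.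

## Disproof used / negatives

No `Cruxes/EveryMetricHearsSphere/Disproof.lean` exists at registration (`ledger crux ls
stmt-SmoothPoincare4-7413`: no workfiles, 2026-08-17); `ledger negatives --problem SmoothPoincare4`:
0 refuted statements. The grounder's vendored fact
`Literature.Geometry.Riemannian.karpukhinStern_groundStateHarmonicMap` (KS Cor. 1.3 + Thm. 1.5: ground
states into `S^k`, `k ≥ k₀(M,g)`) is the k-LARGE end of the same mechanism; this line works at `k = 4`
and does not use it.

## BC3 audit (this seat, planner-skel-stmt-SmoothPoincare4-7413-0; raw outputs in NOTES.md `birth-certificate:`)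

`lean check --json` rc 0 with `sorry` exactly in `stub_widthMapHomotopyEquiv`, `stub_lowIndexGroundState`
(sorries = 2 = stub count, zero elsewhere; audit: `EveryMetricHearsSphere_of` "proves
…Theses.SpectralDevelopingMap.EveryMetricHearsSphere only under unregistered hypotheses
[Sig.stub_widthMapHomotopyEquiv, Sig.stub_lowIndexGroundState]", `EveryMetricHearsSphere_proof`
"proof-of-item … NOT closed: axioms [sorryAx]"). Probes (seat folder `bc/probe_stub{1,2}.lean`, vocabulary +
ONE `Sig` def each, no sorried theorem in scope): `example : Sig.stub → EveryMetricHearsSphere` and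
`example : Sig.stub → _root_.SmoothPoincare4` by
`first | exact? | simpa [Sig.stub] | (unfold Sig.stub; simpa) | aesop` under `maxHeartbeats 400000` FAIL
for both stubs (4/4, rc 1); split per tactic (`bc/probe_stub{1,2}_split.lean`, 16/16 fail): `exact?` —
"could not close the goal" (4/4), `simpa [Sig.stub]` / `unfold; simpa` — deterministic timeout at `whnf`
(8/8), `aesop` — "unsolved goals ⊢ EveryMetricHearsSphere" / "⊢ SmoothPoincare4" (4/4).
-/

set_option linter.dupNamespace false
set_option linter.unusedVariables false

noncomputable section

namespace Summit.SmoothPoincare4.SmoothPoincare4.Cruxes.EveryMetricHearsSphere.Birth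

open scoped Manifold ContDiff BigOperators Topology ContinuousMap
open MeasureTheory
open Literature.Geometry.Lorentzian (riemannianMeasure)
open Literature.Geometry.Lorentzian.PseudoRiemannianMetric (ofRiemannian)
open Summit.SmoothPoincare4.SmoothPoincare4.Theses.SpectralDevelopingMap

/-- Local notation: the model space `ℝ⁴`. -/
local notation "ℝ⁴" => EuclideanSpace ℝ (Fin 4)
/-- Local notation: the ambient space `ℝ⁵` of the target sphere. -/
local notation "ℝ⁵" => EuclideanSpace ℝ (Fin 5)
/-- Local notation: the round unit sphere `S⁴ ⊂ ℝ⁵` with Mathlib's `C^∞` structure. -/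
local notation "𝕊⁴" => (Metric.sphere (0 : EuclideanSpace ℝ (Fin 5)) 1)

/-! ### Vocabulary of the seam (plain `def`s over route-file declarations) -/

/-- `gradNormSq g w x = |dw|²_g (x) = Σᵢ g⁻¹(dwᵢ, dwᵢ)` for a vector-valued `w : M → ℝ⁵`
(with `w = Φ` this is the energy density `E` of the crux, clause by clause). -/
def gradNormSq {M : Type} [TopologicalSpace M] [ChartedSpace ℝ⁴ M] [IsManifold (𝓡 4) ∞ M]
    (g : Bundle.ContMDiffRiemannianMetric (𝓡 4) ∞ ℝ⁴ (TangentSpace (𝓡 4) : M → Type _))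
    (w : M → ℝ⁵) (x : M) : ℝ :=
  ∑ i : Fin 5, (ofRiemannian g).innerDual x
    (mvfderiv (𝓡 4) (fun y => w y i) x).toLinearMap
    (mvfderiv (𝓡 4) (fun y => w y i) x).toLinearMap

/-- `secondVariation g E w = Q(w) = ∫_M (|dw|²_g − E |w|²) dv_g`: the second variation of the
Dirichlet energy at a harmonic map into the round sphere with energy density `E = |dΦ|²_g`, along a
tangential variation field `w` (Karpukhin–Stern 2024, p. 12; for sphere targets the curvature term of
`E''` is `−|du|²|w|²`). -/
def secondVariation {M : Type} [TopologicalSpace M] [ChartedSpace ℝ⁴ M] [IsManifold (𝓡 4) ∞ M]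
    [T3Space M] [MeasurableSpace M] [BorelSpace M]
    (g : Bundle.ContMDiffRiemannianMetric (𝓡 4) ∞ ℝ⁴ (TangentSpace (𝓡 4) : M → Type _))
    (E : M → ℝ) (w : M → ℝ⁵) : ℝ :=
  ∫ x, (gradNormSq g w x - E x * ‖w x‖ ^ 2) ∂(riemannianMeasure g)

/-- `EnergyIndexAtMost g Φ E m`: the Morse index `ind_E(Φ)` of `Φ : (M,g) → S⁴` (energy density `E`)
is at most `m` on smooth tangential variations — among any `m + 1` smooth fields `v_a : M → ℝ⁵`
tangent to the sphere along `Φ` (`⟪v_a(x), Φ(x)⟫ = 0`) some non-trivial linear combination has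
non-negative second variation (no `(m+1)`-dimensional negative space). -/
def EnergyIndexAtMost {M : Type} [TopologicalSpace M] [ChartedSpace ℝ⁴ M] [IsManifold (𝓡 4) ∞ M]
    [T3Space M] [MeasurableSpace M] [BorelSpace M]
    (g : Bundle.ContMDiffRiemannianMetric (𝓡 4) ∞ ℝ⁴ (TangentSpace (𝓡 4) : M → Type _))
    (Φ : M → 𝕊⁴) (E : M → ℝ) (m : ℕ) : Prop :=
  ∀ v : Fin (m + 1) → M → ℝ⁵,
    (∀ a, ContMDiff (𝓡 4) 𝓘(ℝ, ℝ⁵) ∞ (v a)) →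
    (∀ a x, inner ℝ (v a x) (Φ x : ℝ⁵) = 0) →
      ∃ c : Fin (m + 1) → ℝ, c ≠ 0 ∧ 0 ≤ secondVariation g E (fun x => ∑ a, c a • v a x)

/-! ### Stub signatures (`Sig.stub_*`, so that the hypothesis heads of `EveryMetricHearsSphere_of`
carry the registered stub names) -/

/-- STUB 1 — A LOW-INDEX HARMONIC HOMOTOPY EQUIVALENCE FOR EVERY METRIC (KSWidthMapDegreeOne).
For every closed smooth `M ≃ₕ S⁴` and every Riemannian `g` there are a smooth `Φ : M → S⁴`, equal to a
homotopy equivalence, and `E = |dΦ|²_g` with `Δ_g Φᵢ = −E Φᵢ` (harmonic into the round sphere) and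
Morse index `ind_E(Φ) ≤ 5` (`EnergyIndexAtMost g Φ E 5`). Karpukhin–Stern Cor. 1.3 at `n = k = 4` gives
all of it except the homotopy-equivalence clause. -/
def Sig.stub_widthMapHomotopyEquiv : Prop :=
  ∀ (M : Type) [TopologicalSpace M] [T2Space M] [SecondCountableTopology M] [ChartedSpace ℝ⁴ M]
    [IsManifold (𝓡 4) ∞ M] [CompactSpace M] [T3Space M] [MeasurableSpace M] [BorelSpace M]
    (g : Bundle.ContMDiffRiemannianMetric (𝓡 4) ∞ ℝ⁴ (TangentSpace (𝓡 4) : M → Type _))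
    (_ : (ofRiemannian g).HasLeviCivita),
    Nonempty (M ≃ₕ 𝕊⁴) →
      ∃ (Φ : M → 𝕊⁴) (E : M → ℝ),
        ContMDiff (𝓡 4) (𝓡 4) ∞ Φ ∧
        (∃ e : M ≃ₕ 𝕊⁴, (e : M → 𝕊⁴) = Φ) ∧
        (∀ x, E x = ∑ i : Fin 5, (ofRiemannian g).innerDual x
            (mvfderiv (𝓡 4) (fun y => (Φ y : ℝ⁵) i) x).toLinearMap
            (mvfderiv (𝓡 4) (fun y => (Φ y : ℝ⁵) i) x).toLinearMap) ∧
        (∀ (i : Fin 5) (x : M), (ofRiemannian g).dalembertian (fun y => (Φ y : ℝ⁵) i) x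
            = -(E x) * (Φ x : ℝ⁵) i) ∧
        EnergyIndexAtMost g Φ E 5

/-- STUB 2 — MORSE INDEX FIVE FORCES SPECTRAL INDEX ONE (KSWidthMapGroundState).
On a closed smooth `M ≃ₕ S⁴` with any Riemannian `g`: a smooth harmonic `Φ : (M,g) → S⁴` (`E = |dΦ|²_g`,
`Δ_g Φᵢ = −E Φᵢ`) which is a homotopy equivalence and has `ind_E(Φ) ≤ 5` is a ground state:
`λ₁(g, E) ≥ 1` in Rayleigh form (the crux's last clause verbatim). -/
def Sig.stub_lowIndexGroundState : Prop :=
  ∀ (M : Type) [TopologicalSpace M] [T2Space M] [SecondCountableTopology M] [ChartedSpace ℝ⁴ M]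
    [IsManifold (𝓡 4) ∞ M] [CompactSpace M] [T3Space M] [MeasurableSpace M] [BorelSpace M]
    (g : Bundle.ContMDiffRiemannianMetric (𝓡 4) ∞ ℝ⁴ (TangentSpace (𝓡 4) : M → Type _))
    (_ : (ofRiemannian g).HasLeviCivita),
    Nonempty (M ≃ₕ 𝕊⁴) →
      ∀ (Φ : M → 𝕊⁴) (E : M → ℝ),
        ContMDiff (𝓡 4) (𝓡 4) ∞ Φ →
        (∃ e : M ≃ₕ 𝕊⁴, (e : M → 𝕊⁴) = Φ) →
        (∀ x, E x = ∑ i : Fin 5, (ofRiemannian g).innerDual x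
            (mvfderiv (𝓡 4) (fun y => (Φ y : ℝ⁵) i) x).toLinearMap
            (mvfderiv (𝓡 4) (fun y => (Φ y : ℝ⁵) i) x).toLinearMap) →
        (∀ (i : Fin 5) (x : M), (ofRiemannian g).dalembertian (fun y => (Φ y : ℝ⁵) i) x
            = -(E x) * (Φ x : ℝ⁵) i) →
        EnergyIndexAtMost g Φ E 5 →
          ∀ u : M → ℝ, ContMDiff (𝓡 4) 𝓘(ℝ, ℝ) ∞ u →
            ∫ x, E x * u x ∂(riemannianMeasure g) = 0 →
            ∫ x, E x * u x ^ 2 ∂(riemannianMeasure g) ≤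
              ∫ x, (ofRiemannian g).innerDual x (mvfderiv (𝓡 4) u x).toLinearMap
                (mvfderiv (𝓡 4) u x).toLinearMap ∂(riemannianMeasure g)

/-! ### The two registered stubs -/

/-- Registered stub 1 (topological half — existence of a low-index harmonic homotopy equivalence;
load-bearing, hardest). Sources: KarpukhinStern2024 Cor. 1.3; White1986; EellsRatto1993. -/
theorem stub_widthMapHomotopyEquiv : Sig.stub_widthMapHomotopyEquiv := by
  sorry

/-- Registered stub 2 (analytic half — Morse index `≤ 5` forces spectral index `1` for harmonic
homotopy equivalences of homotopy 4-spheres). Sources: KarpukhinStern2024 §4.3 (Def. 4.8, Prop. 4.9,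
(4.8)), Kar20 (Karpukhin, Invent. Math. 2021, Props. 1.7, 3.11), ElsoufiIlias2008. -/
theorem stub_lowIndexGroundState : Sig.stub_lowIndexGroundState := by
  sorry

/-! ### Composition -/

/-- **The line closes the crux BY NAME modulo the two registered stubs.** Given `M, g` and a homotopy
equivalence with `S⁴`, stub 1 supplies `Φ, E` with the crux's first four clauses and `ind_E(Φ) ≤ 5`;
stub 2 turns those into the fifth clause (the Rayleigh inequality). [bookkeeping] -/
theorem EveryMetricHearsSphere_of :
    Sig.stub_widthMapHomotopyEquiv → Sig.stub_lowIndexGroundState → EveryMetricHearsSphere := by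
  intro h₁ h₂
  unfold EveryMetricHearsSphere
  intro M _ _ _ _ _ _ _ _ _ g hg hM
  obtain ⟨Φ, E, hΦ, he, hE, hΔ, hind⟩ := h₁ M g hg hM
  exact ⟨Φ, E, hΦ, he, hE, hΔ, h₂ M g hg hM Φ E hΦ he hE hΔ hind⟩

/-- The skeleton in its final shape: the crux BY NAME from the two registered stubs; it becomes the
crux proof when the last `stub_*` is discharged (until then it depends on `sorryAx` through the stubs
only — no `sorry` of its own). -/
theorem EveryMetricHearsSphere_proof : EveryMetricHearsSphere :=
  EveryMetricHearsSphere_of stub_widthMapHomotopyEquiv stub_lowIndexGroundState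

end Summit.SmoothPoincare4.SmoothPoincare4.Cruxes.EveryMetricHearsSphere.Birth

end
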